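import Summits.BirchSwinnertonDyer.BirchSwinnertonDyer.Theses.ByReductionTypeAtTwo
import Summits.BirchSwinnertonDyer.BirchSwinnertonDyer.Theorems.TwoAdicConverseMazurMCOfLambdaHalf
import Summits.BirchSwinnertonDyer.BirchSwinnertonDyer.Theorems.TwoAdicConverseLambdaHalfInstances
import Summits.BirchSwinnertonDyer.BirchSwinnertonDyer.Theorems.ByReductionTypeAtTwoOrdIsogenyTransport
import Summits.BirchSwinnertonDyer.BirchSwinnertonDyer.Theorems.ByReductionTypeAtTwoOrdEisensteinHalfShaIsogeny
import Summits.BirchSwinnertonDyer.BirchSwinnertonDyer.Theorems.ByReductionTypeAtTwoOrdMissingLowerBoundDefs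
import Summits.BirchSwinnertonDyer.Rank1Residual.X12.CMIsogenyInvariance
import Literature.NumberTheory.EllipticCurves.IsogenyCompProofs
import HarnessLib

/-!
# The descent crux of K4 follows from the Kato crux of K4 and the `λ`-crux of S3: `OrdMissingLowerBoundAtTwo`
# (item 19577) ⟸ PUB ∧ Cassels ∧ `OrdKatoHalfAtTwoIso` (item 19573) ∧ `OrdLambdaHalfAtTwo` (S3 item 19556) ∧
# a `μ_an = 0` member per isogeny class (route ByReductionTypeAtTwo; seat bsd-2adic-ord-3 GEN 5)

HONEST FRAMING (cell `bsd-2adic`, HUMAN RULINGS D-0036/D-0074): THEOREMS ONLY — REDUCTIONS between the cell's OPEN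
`∀`-cruxes, every published input a displayed hypothesis; nothing asserted; no definition; no named fact. None of the
three cruxes is proved here (all research-grade at `p = 2`); BSD is not proved by any of this.

WHAT IS PROVED.
* §1 (per curve, analytic rank `0`, good ordinary at `2`): the descent inequality `MissingLowerBoundAt W 2` (item 19577 AT
  `W`) — and `BSD(W,2)` — from the Kato–Néron half `X5.O1.MainConjectureLowerDivisibilityAtTwoOrd W` (item 19271/19573
  AT `W`), the `λ`-half `TwoAdicTwistConverse.LambdaHalfAtTwo W` (S3 item 19556 AT `W`) and ONE analytic certificate
  `AnalyticMuLE W 2 0` (`μ(ϖ·L₂(f,α)) = 0`), modulo PRINT {modularity `hmod`, GZK `hGZK`, Kato 17.4 (1)(2)@2 `h17`,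
  Greenberg 4.1@2 as `hEC`}: conv-1's `mazurMainConjecture_two_of_lower_of_lambdaHalf_of_analyticMuLE` (the `λ`-pinch:
  `f_X ∣ ϖ·L₂` integrally, `μ(f_X) ≤ μ_an = 0`, `λ(f_X) ≥ λ_an` ⇒ associates) followed by the X5 door
  `missingLowerBoundAt_two_of_eisenstein_of_kato`; conversely the `λ`-half at `W` from the Kato half + the descent
  inequality (`lambdaHalfAtTwo_of_katoHalf_of_missingLowerBoundAt`, through GEN 2's
  `mazurMainConjecture_two_of_katoHalf_of_missingLowerBoundAt`), so that AT a rank-`0` good-ordinary curve with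
  `μ_an = 0` and the Kato half the three statements {descent inequality, `λ`-half, `2`-adic IMC} are EQUIVALENT
  (`missingLowerBoundAt_iff_lambdaHalfAtTwo_of_katoHalf_of_analyticMuLE`). The isogenous form
  `missingLowerBoundAt_two_of_katoHalf_of_lambdaHalf_of_analyticMuLE_of_isIsogenous` reads all three inputs at ANY
  globally minimal member `W'` of the class (Cassels `hCassels`).
* §2 (`∀`-level, the planner's bookkeeping): granted `OrdPublishedInputsAtTwo` + Cassels, the K4 crux
  `OrdKatoHalfAtTwoIso` (19573: integral Kato at SOME member), the S3 crux `OrdLambdaHalfAtTwo` (19556, rank-free) and a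
  `μ_an = 0` WITNESS per class (`hμ`: every non-CM rank-`0` good-ordinary-at-`2` curve is ℚ-isogenous to a globally
  minimal curve with `AnalyticMuLE · 2 0` — a finitely checkable analytic certificate per class; on the 528 open X5
  classes eng-2's CERT-ORD-OPEN528 lists a `μ_an = 0` member for every class) IMPLY the K4 crux
  `OrdMissingLowerBoundAtTwo` (19577) — `ordMissingLowerBoundAtTwo_of_katoHalfIso_of_lambdaHalf`, and the same with the
  route decls of `Theses.ByReductionTypeAtTwo` by name (`…_route`). So, modulo PUB, Cassels, the Kato crux and the
  `μ_an`-witness, the TWO research-grade residues of routes K4 (19577) and S3 (19556) on the good-ordinary rank-`0` block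
  are ONE statement, the `λ`-half — the per-class fact recorded in CENSUS-19577.md §5(b), now `∀`-closed in the kernel.

References: K. Kato, Astérisque 295 (2004), Thm. 17.4; R. Greenberg, LNM 1716 (1999), Thm. 4.1; R. Greenberg,
V. Vatsal, Invent. Math. 142 (2000) pp. 2–4 (λ/μ shape); J. Milne, *Arithmetic Duality Theorems*, Thm. I.7.3
(Cassels); R. L. Miller, LMS J. Comput. Math. 14 (2011), Def. 1.1.
-/

set_option autoImplicit false
-- the sub-problem namespace repeats the summit name by design (D-0017 nested layout)
set_option linter.dupNamespace false

noncomputable section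

open scoped Classical MatrixGroups ModularForm

open CongruenceSubgroup WeierstrassCurve Literature.NumberTheory.EllipticCurves
  Literature.NumberTheory.EllipticCurves.ModularForms Literature.NumberTheory.EllipticCurves.Rank1Residual
  Literature.NumberTheory.EllipticCurves.Rank1Residual.Typed
  Literature.NumberTheory.EllipticCurves.Greenberg1999
  Summit.BirchSwinnertonDyer.Rank1Residual.X1.MuLambda
  Summit.BirchSwinnertonDyer.Rank1Residual.X1.MuPart
  Summit.BirchSwinnertonDyer.Rank1Residual.X1.ParitySqueeze

namespace Summit.BirchSwinnertonDyer.BirchSwinnertonDyer.Theorems.EisensteinShaCurrency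

open Summit.BirchSwinnertonDyer.Rank1Residual Summit.BirchSwinnertonDyer.Rank1Residual.X5
  Summit.BirchSwinnertonDyer.Rank1Residual.X5.O1
  Summit.BirchSwinnertonDyer.BirchSwinnertonDyer.Theorems.Rank1ResidualX1Defs
  Summit.BirchSwinnertonDyer.BirchSwinnertonDyer.Theorems.TwoAdicTwistConverse
  Summit.BirchSwinnertonDyer.BirchSwinnertonDyer.Theorems.IsogenyMuShift

/-! ## §1 Per curve -/

section Curve

variable (W : WeierstrassCurve ℚ) [W.IsElliptic] [W.IsGloballyMinimal]

/-- **`X(E/ℚ_∞)` is torsion at every cyclotomic datum** on a good-ordinary-at-`2` curve, from Kato 17.4 (1) AT `2`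
(`h17`, clause (1)) at the newform supplied by modularity (`hmod`). Bookkeeping.
[cite: Kato2004Asterisque, Thm. 17.4 (1) (p. 273)] -/
theorem isTorsion_of_kato_two (hmod : nonempty_modularParametrizationData)
    (h17 : ∀ [NeZero (W.conductorNorm ℤ)] (f : CuspForm (Gamma0 (W.conductorNorm ℤ)) 2),
      kato_divisibility_allPrimes W 2 (f := f))
    (hgo : GoodOrd W 2) :
    ∀ (κ : ZpExtension ℚ 2) (γ : Field.absoluteGaloisGroup ℚ), κ.IsCyclotomic → κ.IsTopGenerator γ →
      IsCyclotomicVariable 2 γ → ∀ D : W.SelmerDualData κ γ, D.IsTorsion := by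
  have hord : IsOrdinaryAt W 2 := hgo
  haveI : NeZero (W.conductorNorm ℤ) := ⟨(W.conductorNorm_pos_holds).ne'⟩
  obtain ⟨Dm⟩ := hmod W
  exact fun κ γ hκ hγ hγ' D => (h17 Dm.f κ γ hκ hγ hγ' hord Dm.isNewformOf D).1

/-- **The `2`-adic IMC at `W` from the Kato half, the `λ`-half and `μ_an = 0`** (conv-1's `λ`-pinch with `X` torsion
discharged by Kato 17.4 (1)@2): PRINT {`hmod`, `h17`} + {Kato half AT `W`, `λ`-half AT `W`, `AnalyticMuLE W 2 0`}.
[cite: Kato2004Asterisque, Thm. 17.4 (1)(2) (p. 273)] [cite: GreenbergVatsal2000, pp. 2–4 (shape)] -/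
theorem mazurMainConjecture_two_of_katoHalf_of_lambdaHalf_of_analyticMuLE
    (hmod : nonempty_modularParametrizationData)
    (h17 : ∀ [NeZero (W.conductorNorm ℤ)] (f : CuspForm (Gamma0 (W.conductorNorm ℤ)) 2),
      kato_divisibility_allPrimes W 2 (f := f))
    (hgo : GoodOrd W 2) (hK : MainConjectureLowerDivisibilityAtTwoOrd W) (hL : LambdaHalfAtTwo W)
    (hμan : AnalyticMuLE W 2 0) : MazurMainConjecture W 2 :=
  mazurMainConjecture_two_of_lower_of_lambdaHalf_of_analyticMuLE W hgo (isTorsion_of_kato_two W hmod h17 hgo)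
    hK hL hμan

/-- **Item 19577 AT `W` from the Kato half, the `λ`-half (S3 item 19556 AT `W`) and `μ_an = 0`** (analytic rank `0`,
good ordinary at `2`): PRINT {`hmod`, `hGZK`, `h17`, Greenberg 4.1@2 as `hEC`} + {Kato half, `λ`-half, `μ_an = 0`} ⇒
`MissingLowerBoundAt W 2`, through the IMC and the X5 door `missingLowerBoundAt_two_of_eisenstein_of_kato`.
[cite: Kato2004Asterisque, Thm. 17.4 (1)(2) (p. 273)] [cite: GreenbergLNM1716, Thm. 4.1 (p. 102)]
[cite: Miller2011LMS, Def. 1.1] -/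
theorem missingLowerBoundAt_two_of_katoHalf_of_lambdaHalf_of_analyticMuLE
    (hmod : nonempty_modularParametrizationData) (hGZK : rank_eq_analyticRank_of_analyticRank_le_one)
    (h17 : ∀ [NeZero (W.conductorNorm ℤ)] (f : CuspForm (Gamma0 (W.conductorNorm ℤ)) 2),
      kato_divisibility_allPrimes W 2 (f := f))
    (hEC : TwoAdicEulerCharRankZero W 0) (hgo : GoodOrd W 2) (hr : W.analyticRank = 0)
    (hK : MainConjectureLowerDivisibilityAtTwoOrd W) (hL : LambdaHalfAtTwo W) (hμan : AnalyticMuLE W 2 0) :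
    MissingLowerBoundAt W 2 :=
  missingLowerBoundAt_two_of_eisenstein_of_kato W hEC hmod hGZK h17 hr hgo
    (mainConjectureEisensteinDivisibilityAtTwo_of_mazurMainConjecture W fun _ =>
      mazurMainConjecture_two_of_katoHalf_of_lambdaHalf_of_analyticMuLE W hmod h17 hgo hK hL hμan)

/-- **`BSD(W,2)` from the Kato half, the `λ`-half and `μ_an = 0`** (analytic rank `0`, good ordinary at `2`; PRINT
{`hmod`, `hGZK`, `h17`, `hEC`}). [cite: Kato2004Asterisque, Thm. 17.4 (1)(2) (p. 273)]
[cite: GreenbergLNM1716, Thm. 4.1 (p. 102)] [cite: Miller2011LMS, Def. 1.1] -/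
theorem bsdp_two_of_katoHalf_of_lambdaHalf_of_analyticMuLE
    (hmod : nonempty_modularParametrizationData) (hGZK : rank_eq_analyticRank_of_analyticRank_le_one)
    (h17 : ∀ [NeZero (W.conductorNorm ℤ)] (f : CuspForm (Gamma0 (W.conductorNorm ℤ)) 2),
      kato_divisibility_allPrimes W 2 (f := f))
    (hEC : TwoAdicEulerCharRankZero W 0) (hgo : GoodOrd W 2) (hr : W.analyticRank = 0)
    (hK : MainConjectureLowerDivisibilityAtTwoOrd W) (hL : LambdaHalfAtTwo W) (hμan : AnalyticMuLE W 2 0) :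
    BSDp W 2 :=
  bsdp_two_of_katoHalf_of_missingLowerBoundAt W h17 hEC hGZK hmod hgo hr hK
    (missingLowerBoundAt_two_of_katoHalf_of_lambdaHalf_of_analyticMuLE W hmod hGZK h17 hEC hgo hr hK hL hμan)

/-- **Conversely, the `λ`-half AT `W` from the Kato half and the descent inequality** (analytic rank `0`, good
ordinary at `2`; PRINT {`hmod`, `hGZK`, `h17`, `hEC`}; no `μ`-input): through GEN 2's
`mazurMainConjecture_two_of_katoHalf_of_missingLowerBoundAt` and conv-1's `lambdaHalfAtTwo_of_mazurMainConjecture`.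
[cite: Kato2004Asterisque, Thm. 17.4 (1)(2) (p. 273)] [cite: GreenbergLNM1716, Thm. 4.1 (p. 102)]
[cite: GreenbergVatsal2000, pp. 2–4 (shape)] -/
theorem lambdaHalfAtTwo_of_katoHalf_of_missingLowerBoundAt
    (hmod : nonempty_modularParametrizationData) (hGZK : rank_eq_analyticRank_of_analyticRank_le_one)
    (h17 : ∀ [NeZero (W.conductorNorm ℤ)] (f : CuspForm (Gamma0 (W.conductorNorm ℤ)) 2),
      kato_divisibility_allPrimes W 2 (f := f))
    (hEC : TwoAdicEulerCharRankZero W 0) (hgo : GoodOrd W 2) (hr : W.analyticRank = 0)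
    (hK : MainConjectureLowerDivisibilityAtTwoOrd W) (hsha : MissingLowerBoundAt W 2) : LambdaHalfAtTwo W :=
  lambdaHalfAtTwo_of_mazurMainConjecture W hmod
    (mazurMainConjecture_two_of_katoHalf_of_missingLowerBoundAt W h17 hEC hGZK hmod hgo hr hK hsha)

/-- **AT a rank-`0` good-ordinary curve carrying the Kato half and `μ_an = 0`, the descent inequality (K4 item 19577 AT
`W`) and the `λ`-half (S3 item 19556 AT `W`) are EQUIVALENT** (PRINT {`hmod`, `hGZK`, `h17`, `hEC`}).
[cite: Kato2004Asterisque, Thm. 17.4 (1)(2) (p. 273)] [cite: GreenbergLNM1716, Thm. 4.1 (p. 102)] [cite: Miller2011LMS, Def. 1.1] -/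
theorem missingLowerBoundAt_iff_lambdaHalfAtTwo_of_katoHalf_of_analyticMuLE
    (hmod : nonempty_modularParametrizationData) (hGZK : rank_eq_analyticRank_of_analyticRank_le_one)
    (h17 : ∀ [NeZero (W.conductorNorm ℤ)] (f : CuspForm (Gamma0 (W.conductorNorm ℤ)) 2),
      kato_divisibility_allPrimes W 2 (f := f))
    (hEC : TwoAdicEulerCharRankZero W 0) (hgo : GoodOrd W 2) (hr : W.analyticRank = 0)
    (hK : MainConjectureLowerDivisibilityAtTwoOrd W) (hμan : AnalyticMuLE W 2 0) :
    MissingLowerBoundAt W 2 ↔ LambdaHalfAtTwo W :=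
  ⟨lambdaHalfAtTwo_of_katoHalf_of_missingLowerBoundAt W hmod hGZK h17 hEC hgo hr hK,
    fun hL => missingLowerBoundAt_two_of_katoHalf_of_lambdaHalf_of_analyticMuLE W hmod hGZK h17 hEC hgo hr hK hL hμan⟩

/-- **The isogenous form: item 19577 AT `W` from the three inputs at ANY isogenous globally minimal `W'`.** `W` of
analytic rank `0`, good ordinary at `2`, `W ∼ W'`; Kato half, `λ`-half and `μ_an = 0` AT `W'`; PRINT {`hmod`, `hGZK`,
`h17` at `W'`, Greenberg 4.1@2 `hGr`, Cassels `hCassels`}. (Good ordinary reduction and the analytic rank move along the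
isogeny; the inequality comes back by Cassels + GZK, `missingLowerBoundAt_two_of_isIsogenous`.)
[cite: MilneADT2006, Thm. I.7.3] [cite: Kato2004Asterisque, Thm. 17.4 (1)(2) (p. 273)] [cite: GreenbergLNM1716, Thm. 4.1 (p. 102)] -/
theorem missingLowerBoundAt_two_of_katoHalf_of_lambdaHalf_of_analyticMuLE_of_isIsogenous
    (hmod : nonempty_modularParametrizationData) (hGZK : rank_eq_analyticRank_of_analyticRank_le_one)
    (hGr : Greenberg1999.thm41_charValue_rankZero_anyPrime) (hCassels : bsdRHS_eq_of_isIsogenous)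
    (hgo : GoodOrd W 2) (hr : W.analyticRank = 0)
    {W' : WeierstrassCurve ℚ} [W'.IsElliptic] [W'.IsGloballyMinimal] (hiso : IsIsogenous W W')
    (h17' : ∀ [NeZero (W'.conductorNorm ℤ)] (f : CuspForm (Gamma0 (W'.conductorNorm ℤ)) 2),
      kato_divisibility_allPrimes W' 2 (f := f))
    (hK' : MainConjectureLowerDivisibilityAtTwoOrd W') (hL' : LambdaHalfAtTwo W') (hμan' : AnalyticMuLE W' 2 0) :
    MissingLowerBoundAt W 2 :=
  have hgo' : GoodOrd W' 2 := isOrdinaryAt_of_isIsogenous hiso hgo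
  have hr' : W'.analyticRank = 0 := by rw [← analyticRank_eq_of_isIsogenous' hiso]; exact hr
  missingLowerBoundAt_two_of_isIsogenous W hCassels hGZK hmod hr hiso
    (missingLowerBoundAt_two_of_katoHalf_of_lambdaHalf_of_analyticMuLE W' hmod hGZK h17'
      (twoAdicEulerCharRankZero_zero_of_greenberg W' hGr) hgo' hr' hK' hL' hμan')

end Curve

/-! ## §2 The `∀`-closed reduction between the cruxes -/

section Crux

/-- **K4's descent crux from K4's Kato crux + S3's `λ`-crux + a `μ_an = 0` witness per class.** Granted
`OrdPublishedInputsAtTwo` (modularity, GZK, Kato 17.4 (1)(2) AT `2`, Greenberg 4.1@2) and Cassels (`hCassels`): IF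
(`hβ`, = the body of `Theses.ByReductionTypeAtTwo.OrdKatoHalfAtTwoIso`, item 19573) every non-CM rank-`0`
good-ordinary-at-`2` curve is isogenous to a globally minimal curve carrying the Kato–Néron half, AND (`hΛ`, =
`TwoAdicTwistConverse.OrdLambdaHalfAtTwo` = the S3 route decl `Theses.TwoAdicConverse.OrdLambdaHalfAtTwo`, item 19556)
the `λ`-half holds at every non-CM good-ordinary-at-`2` curve, AND (`hμ`) every such rank-`0` curve is isogenous to a
globally minimal curve with `μ_an = 0` (`AnalyticMuLE · 2 0`), THEN `Theorems.OrdHalvesAtTwo.OrdMissingLowerBoundAtTwo`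
(= the K4 route decl `OrdMissingLowerBoundAtTwo`, item 19577). Proof: move to the `μ_an = 0` member `W″` (non-CM, rank
`0`, good ordinary are isogeny invariants), transport the Kato half to it (`katoHalf_isogenyInvariant`), apply §1 there,
and pull the inequality back by Cassels. [cite: Kato2004Asterisque, Thm. 17.4 (1)(2) (p. 273)]
[cite: GreenbergLNM1716, Thm. 4.1 (p. 102)] [cite: MilneADT2006, Thm. I.7.3] [cite: Miller2011LMS, Def. 1.1] -/
theorem ordMissingLowerBoundAtTwo_of_katoHalfIso_of_lambdaHalf
    (hPub : Literature.Uncategorized.OrdPublishedInputsAtTwo) (hCassels : bsdRHS_eq_of_isIsogenous)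
    (hβ : ∀ (W : WeierstrassCurve ℚ) [W.IsElliptic] [W.IsGloballyMinimal], ¬ W.HasCM →
      W.analyticRank = 0 → GoodOrd W 2 →
      ∃ (W' : WeierstrassCurve ℚ) (_ : W'.IsElliptic) (_ : W'.IsGloballyMinimal),
        IsIsogenous W W' ∧ MainConjectureLowerDivisibilityAtTwoOrd W')
    (hΛ : TwoAdicTwistConverse.OrdLambdaHalfAtTwo)
    (hμ : ∀ (W : WeierstrassCurve ℚ) [W.IsElliptic] [W.IsGloballyMinimal], ¬ W.HasCM →
      W.analyticRank = 0 → GoodOrd W 2 →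
      ∃ (W'' : WeierstrassCurve ℚ) (_ : W''.IsElliptic) (_ : W''.IsGloballyMinimal),
        IsIsogenous W W'' ∧ AnalyticMuLE W'' 2 0) :
    Summit.BirchSwinnertonDyer.BirchSwinnertonDyer.Theorems.OrdHalvesAtTwo.OrdMissingLowerBoundAtTwo := by
  have hPub' := hPub
  obtain ⟨hmod, hGZK, h17, hGr⟩ := hPub'
  intro W _ _ hcm hr hgo
  obtain ⟨W', _, _, hiso', hK'⟩ := hβ W hcm hr hgo
  obtain ⟨W'', _, _, hiso'', hμ''⟩ := hμ W hcm hr hgo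
  have hcm'' : ¬ W''.HasCM := fun h => hcm ((X12.hasCM_iff_of_isIsogenous hiso'').mpr h)
  have hr'' : W''.analyticRank = 0 := by rw [← analyticRank_eq_of_isIsogenous' hiso'']; exact hr
  have hgo'' : GoodOrd W'' 2 := isOrdinaryAt_of_isIsogenous hiso'' hgo
  have hK'' : MainConjectureLowerDivisibilityAtTwoOrd W'' :=
    katoHalf_isogenyInvariant hPub hCassels (hiso''.symm_of_charZero.trans' hiso') hgo'' hr'' hK'
  exact missingLowerBoundAt_two_of_isIsogenous W hCassels hGZK hmod hr hiso''
    (missingLowerBoundAt_two_of_katoHalf_of_lambdaHalf_of_analyticMuLE W'' hmod hGZK (h17 W'')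
      (twoAdicEulerCharRankZero_zero_of_greenberg W'' hGr) hgo'' hr'' hK'' (hΛ W'' hcm'' hgo'') hμ'')

/-- **The same between the ROUTE DECLS of `Theses.ByReductionTypeAtTwo`, by name:** `OrdPublishedInputsAtTwo` ∧
Cassels ∧ `OrdKatoHalfAtTwoIso` (item 19573) ∧ the S3 `λ`-crux (`TwoAdicTwistConverse.OrdLambdaHalfAtTwo`, `Iff.rfl`
with `Theses.TwoAdicConverse.OrdLambdaHalfAtTwo`, item 19556) ∧ a `μ_an = 0` witness per class ⇒
`OrdMissingLowerBoundAtTwo` (item 19577). [cite: Kato2004Asterisque, Thm. 17.4 (1)(2) (p. 273)]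
[cite: GreenbergLNM1716, Thm. 4.1 (p. 102)] [cite: MilneADT2006, Thm. I.7.3] -/
theorem ordMissingLowerBoundAtTwo_of_katoHalfIso_of_lambdaHalf_route
    (hPub : Summit.BirchSwinnertonDyer.BirchSwinnertonDyer.Theses.ByReductionTypeAtTwo.OrdPublishedInputsAtTwo)
    (hCassels : bsdRHS_eq_of_isIsogenous)
    (hK : Summit.BirchSwinnertonDyer.BirchSwinnertonDyer.Theses.ByReductionTypeAtTwo.OrdKatoHalfAtTwoIso)
    (hΛ : TwoAdicTwistConverse.OrdLambdaHalfAtTwo)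
    (hμ : ∀ (W : WeierstrassCurve ℚ) [W.IsElliptic] [W.IsGloballyMinimal], ¬ W.HasCM →
      W.analyticRank = 0 → GoodOrd W 2 →
      ∃ (W'' : WeierstrassCurve ℚ) (_ : W''.IsElliptic) (_ : W''.IsGloballyMinimal),
        IsIsogenous W W'' ∧ AnalyticMuLE W'' 2 0) :
    Summit.BirchSwinnertonDyer.BirchSwinnertonDyer.Theses.ByReductionTypeAtTwo.OrdMissingLowerBoundAtTwo :=
  ordMissingLowerBoundAtTwo_of_katoHalfIso_of_lambdaHalf hPub hCassels hK hΛ hμ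

end Crux

end Summit.BirchSwinnertonDyer.BirchSwinnertonDyer.Theorems.EisensteinShaCurrency

end
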